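import Literature.AlgebraicTopology.SingularHomology.DeformationRetractHomology
import Literature.AlgebraicTopology.SingularHomology.LocalHomologyVanishing
import HarnessLib

/-!
# Radial deformations, and `Hⱼ(D, annulus) ≅ Hⱼ(D, ∂D)` for a closed ball

Elementary homotopy/homology book-keeping around closed balls of a real normed space, of the kind
used implicitly throughout Hatcher's §2.1 (e.g. in Example 2.17 and the proof of Prop. 2.22, where
a collar annulus of `∂Dⁿ` is pushed radially onto `∂Dⁿ`):

* `Literature.AlgebraicTopology.SingularHomology.annulus a b = {x | a ≤ ‖x‖ ≤ b}` and
  `Literature.AlgebraicTopology.SingularHomology.isStrongDeformationRetractOf_sphere_annulus`: for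
  `0 < a ≤ b` the outer sphere `‖x‖ = b` is a strong deformation retract of the annulus (the
  radial deformation `x ↦ ((1 - t) + t b/‖x‖) x`), in the tree's sense
  `Literature.AlgebraicTopology.Homotopy.IsStrongDeformationRetractOf`;
* `Literature.AlgebraicTopology.SingularHomology.relativeSingularHomology.isIso_map_of_isZero`: for
  `B ⊆ A ⊆ X` with `H⁎(A, B) = 0`, the maps `Hⱼ(X, B) → Hⱼ(X, A)` are isomorphisms (exact
  sequence of the triple, Hatcher p. 118);
* `Literature.AlgebraicTopology.SingularHomology.closedBallAnnulusIso`: for `0 < r₁ ≤ r₂`,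
  `Hⱼ(D_{r₂}, D_{r₂} ∩ {r₁ ≤ ‖x‖}) ≅ Hⱼ(D₁, ∂D₁)` (`D_r` the closed ball of radius `r`): the annulus
  retracts onto `∂D_{r₂}`, and `D_{r₂} ≅ D₁` by scaling.

## References

* A. Hatcher, *Algebraic Topology*, CUP 2002, Ch. 0, p. 2 (deformation retractions), §2.1,
  p. 118 (exact sequence of a triple), Prop. 2.22 and Example 2.17. [HatcherAT2002]
-/

noncomputable section

open CategoryTheory Limits Set unitInterval Metric
open Literature.AlgebraicTopology.Homotopy

universe u v

namespace Literature.AlgebraicTopology.SingularHomology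

variable (R : Type v) [CommRing R] (M : Type v) [AddCommGroup M] [Module R M]

/-! ### `H⁎(A, B) = 0` makes `Hⱼ(X, B) → Hⱼ(X, A)` an isomorphism -/

namespace relativeSingularHomology

variable {X : Type u} [TopologicalSpace X]

/-- **If `B ⊆ A ⊆ X` and `H⁎(A, B) = 0`, then `Hⱼ(X, B) → Hⱼ(X, A)` is an isomorphism for every
`j`** (exact sequence of the triple, Hatcher 2002, p. 118: one-to-one because `Hⱼ(A, B) = 0`,
onto because `Hⱼ₋₁(A, B) = 0`, and in degree `0` because `H₀(X) → H₀(X, A)` is onto).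
[cite: HatcherAT2002, §2.1, p. 118 (exact sequence of a triple)] -/
theorem isIso_map_of_isZero {A B : Set X} (h : B ⊆ A)
    (hz : ∀ i, IsZero (relativeSingularHomology R M (↥A) (Subtype.val ⁻¹' B) i)) (j : ℕ) :
    IsIso (map R M (ContinuousMap.id X) (mapsTo_id_of_subset h) j) := by
  haveI : Mono (map R M (ContinuousMap.id X) (mapsTo_id_of_subset h) j) :=
    (triple_exact₂ R M h j).mono_g ((hz j).eq_of_src _ _)
  haveI : Epi (map R M (ContinuousMap.id X) (mapsTo_id_of_subset h) j) := by
    cases j with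
    | zero =>
      haveI := epi_ofAbsolute_zero R M (X := X) A
      have hfac : ofAbsolute R M X B 0 ≫ map R M (ContinuousMap.id X) (mapsTo_id_of_subset h) 0 =
          ofAbsolute R M X A 0 := by
        rw [ofAbsolute_comp_map, singularHomology.map_id, Category.id_comp]
      exact epi_of_epi_fac hfac
    | succ n => exact (triple_exact₃ R M h n).epi_f ((hz n).eq_of_tgt _ _)
  exact isIso_of_mono_of_epi _

end relativeSingularHomology

/-! ### Annuli and the radial deformation -/

section Radial

variable {E : Type u} [NormedAddCommGroup E] [NormedSpace ℝ E]

/-- The closed annulus `{x | a ≤ ‖x‖ ≤ b}` of a real normed space. [folklore] -/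
def annulus (a b : ℝ) : Set E := {x | a ≤ ‖x‖ ∧ ‖x‖ ≤ b}

omit [NormedSpace ℝ E] in
/-- Membership in the annulus. [folklore] -/
@[simp]
theorem mem_annulus {a b : ℝ} {x : E} : x ∈ annulus a b ↔ a ≤ ‖x‖ ∧ ‖x‖ ≤ b := Iff.rfl

omit [NormedSpace ℝ E] in
/-- The outer sphere lies in the annulus. [folklore] -/
theorem sphere_subset_annulus {a b : ℝ} (hab : a ≤ b) : sphere (0 : E) b ⊆ annulus a b :=
  fun x hx => by
    rw [mem_sphere_zero_iff_norm] at hx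
    exact ⟨hx ▸ hab, hx.le⟩

omit [NormedSpace ℝ E] in
/-- The annulus lies in the closed ball. [folklore] -/
theorem annulus_subset_closedBall (a b : ℝ) : (annulus a b : Set E) ⊆ closedBall 0 b :=
  fun _ hx => mem_closedBall_zero_iff.mpr hx.2

omit [NormedSpace ℝ E] in
/-- The annulus is closed. [folklore] -/
theorem isClosed_annulus (a b : ℝ) : IsClosed (annulus a b : Set E) :=
  (isClosed_le continuous_const continuous_norm).inter (isClosed_le continuous_norm continuous_const)

/-- **The radial deformation**: `(t, x) ↦ ((1 - t) + t b/‖x‖) x`. [folklore] -/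
def annulusDeformation (b : ℝ) (t : ℝ) (x : E) : E := ((1 - t) + t * (b / ‖x‖)) • x

/-- The radial deformation is continuous on `ℝ × {x ≠ 0}`, hence on `[0, 1] × annulus`.
[folklore] -/
theorem continuousOn_annulusDeformation {a : ℝ} (ha : 0 < a) (b c : ℝ) :
    ContinuousOn (fun p : ℝ × E => annulusDeformation b p.1 p.2) (Icc (0 : ℝ) 1 ×ˢ annulus a c) := by
  refine ContinuousOn.smul ?_ continuousOn_snd
  refine (continuousOn_const.sub continuousOn_fst).add (continuousOn_fst.mul
    (continuousOn_const.div (continuous_norm.comp_continuousOn continuousOn_snd) fun p hp => ?_))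
  exact (ha.trans_le (mem_annulus.mp hp.2).1).ne'

/-- The norm of the radial deformation on the annulus: `‖H_t x‖ = (1 - t) ‖x‖ + t b`. [folklore] -/
theorem norm_annulusDeformation {a b : ℝ} (ha : 0 < a) (hb : 0 ≤ b) {t : ℝ} (ht : t ∈ Icc (0 : ℝ) 1)
    {x : E} (hx : a ≤ ‖x‖) : ‖annulusDeformation b t x‖ = (1 - t) * ‖x‖ + t * b := by
  have hx0 : 0 < ‖x‖ := ha.trans_le hx
  have hcoef : 0 ≤ (1 - t) + t * (b / ‖x‖) :=
    add_nonneg (by linarith [ht.2]) (mul_nonneg ht.1 (div_nonneg hb hx0.le))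
  rw [annulusDeformation, norm_smul, Real.norm_of_nonneg hcoef, add_mul, mul_assoc,
    div_mul_cancel₀ b hx0.ne']

/-- **For `0 < a ≤ b`, the outer sphere `‖x‖ = b` is a strong deformation retract of the annulus
`a ≤ ‖x‖ ≤ b`**, by the radial deformation (Hatcher 2002, Ch. 0, p. 2; as used for the collar of
`∂Dⁿ` in the proof of Prop. 2.22). [cite: HatcherAT2002, Ch. 0, p. 2] -/
theorem isStrongDeformationRetractOf_sphere_annulus {a b : ℝ} (ha : 0 < a) (hab : a ≤ b) :
    IsStrongDeformationRetractOf (sphere (0 : E) b) (annulus a b) := by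
  have hb : 0 ≤ b := ha.le.trans hab
  refine IsStrongDeformationRetractOf.of_continuousOn (annulusDeformation b)
    (continuousOn_annulusDeformation ha b b) (fun t ht x hx => ?_) (fun x _ => ?_) (fun x hx => ?_)
    (fun t _ x hx hxb => ?_)
  · have hn := norm_annulusDeformation ha hb ht hx.1
    refine ⟨?_, ?_⟩
    · rw [hn]
      nlinarith [hx.1, hx.2, ht.1, ht.2]
    · rw [hn]
      nlinarith [hx.1, hx.2, ht.1, ht.2]
  · simp [annulusDeformation]
  · rw [mem_sphere_zero_iff_norm, norm_annulusDeformation ha hb ⟨zero_le_one, le_rfl⟩ hx.1]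
    ring
  · rw [mem_sphere_zero_iff_norm] at hxb
    have hx0 : ‖x‖ ≠ 0 := by rw [hxb]; exact (ha.trans_le hab).ne'
    rw [annulusDeformation, hxb, div_self (hxb ▸ hx0), mul_one, sub_add_cancel, one_smul]

/-- `H⁎(annulus, outer sphere) = 0` for `0 < a ≤ b`. [cite: HatcherAT2002, §2.1 (Prop. 2.19 with Ch. 0, p. 2)] -/
theorem isZero_relativeSingularHomology_annulus_sphere {a b : ℝ} (ha : 0 < a) (hab : a ≤ b) (n : ℕ) :
    IsZero (relativeSingularHomology R M (↥(annulus a b : Set E)) (Subtype.val ⁻¹' sphere (0 : E) b) n) :=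
  (isStrongDeformationRetractOf_sphere_annulus ha hab).isZero_relativeSingularHomology R M
    (sphere_subset_annulus hab) n

end Radial

/-! ### `Hⱼ(D_{r₂}, D_{r₂} ∩ {r₁ ≤ ‖x‖}) ≅ Hⱼ(D₁, ∂D₁)` -/

section DiscAnnulus

variable {E : Type u} [NormedAddCommGroup E]

/-- The trace `{x ∈ D_{r₂} | r₁ ≤ ‖x‖}` of the annulus on the closed ball is homeomorphic to the
annulus. [folklore] -/
def closedBallAnnulusHomeomorph (r₁ r₂ : ℝ) :
    ↥({x : ↥(closedBall (0 : E) r₂) | r₁ ≤ ‖(x : E)‖} : Set ↥(closedBall (0 : E) r₂)) ≃ₜ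
      ↥(annulus r₁ r₂ : Set E) where
  toFun z := ⟨z.1.1, z.2, mem_closedBall_zero_iff.mp z.1.2⟩
  invFun x := ⟨⟨x.1, mem_closedBall_zero_iff.mpr x.2.2⟩, x.2.1⟩
  left_inv _ := rfl
  right_inv _ := rfl
  continuous_toFun := by fun_prop
  continuous_invFun := by fun_prop

/-- `closedBallAnnulusHomeomorph` is a map of pairs (outer sphere to outer sphere). [folklore] -/
theorem mapsTo_closedBallAnnulusHomeomorph (r₁ r₂ : ℝ) :
    MapsTo (closedBallAnnulusHomeomorph (E := E) r₁ r₂)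
      (Subtype.val ⁻¹' (Subtype.val ⁻¹' sphere (0 : E) r₂ : Set ↥(closedBall (0 : E) r₂)))
      (Subtype.val ⁻¹' sphere (0 : E) r₂) :=
  fun _ hz => hz

/-- The inverse of `closedBallAnnulusHomeomorph` is a map of pairs. [folklore] -/
theorem mapsTo_closedBallAnnulusHomeomorph_symm (r₁ r₂ : ℝ) :
    MapsTo (closedBallAnnulusHomeomorph (E := E) r₁ r₂).symm (Subtype.val ⁻¹' sphere (0 : E) r₂)
      (Subtype.val ⁻¹' (Subtype.val ⁻¹' sphere (0 : E) r₂ : Set ↥(closedBall (0 : E) r₂))) :=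
  fun _ hx => hx

/-- The outer sphere lies in the trace of the annulus. [folklore] -/
theorem sphere_subset_closedBall_annulus {r₁ r₂ : ℝ} (h₁₂ : r₁ ≤ r₂) :
    (Subtype.val ⁻¹' sphere (0 : E) r₂ : Set ↥(closedBall (0 : E) r₂)) ⊆
      {x : ↥(closedBall (0 : E) r₂) | r₁ ≤ ‖(x : E)‖} := by
  intro x hx
  change r₁ ≤ ‖(x : E)‖
  rw [show ‖(x : E)‖ = r₂ from mem_sphere_zero_iff_norm.mp hx]
  exact h₁₂

variable [NormedSpace ℝ E]

/-- `H⁎(D_{r₂} ∩ {r₁ ≤ ‖x‖}, ∂D_{r₂}) = 0` for `0 < r₁ ≤ r₂` (the trace of the annulus retracts onto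
the outer sphere). [cite: HatcherAT2002, §2.1 (Prop. 2.19 with Ch. 0, p. 2)] -/
theorem isZero_relativeSingularHomology_closedBall_annulus_sphere {r₁ r₂ : ℝ} (h₁ : 0 < r₁)
    (h₁₂ : r₁ ≤ r₂) (n : ℕ) :
    IsZero (relativeSingularHomology R M
      (↥({x : ↥(closedBall (0 : E) r₂) | r₁ ≤ ‖(x : E)‖} : Set ↥(closedBall (0 : E) r₂)))
      (Subtype.val ⁻¹' (Subtype.val ⁻¹' sphere (0 : E) r₂ : Set ↥(closedBall (0 : E) r₂))) n) :=
  (isZero_relativeSingularHomology_annulus_sphere R M h₁ h₁₂ n).of_iso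
    (relativeSingularHomology.mapHomeomorph R M (closedBallAnnulusHomeomorph r₁ r₂)
      (mapsTo_closedBallAnnulusHomeomorph r₁ r₂) (mapsTo_closedBallAnnulusHomeomorph_symm r₁ r₂) n)

/-- **`Hⱼ(D_{r₂}, ∂D_{r₂}) ≅ Hⱼ(D_{r₂}, D_{r₂} ∩ {r₁ ≤ ‖x‖})`** for `0 < r₁ ≤ r₂` (exact sequence of
the triple and the retraction of the annulus onto the outer sphere).
[cite: HatcherAT2002, §2.1, p. 118 (exact sequence of a triple), with Ch. 0, p. 2] -/
theorem isIso_map_closedBall_sphere_annulus {r₁ r₂ : ℝ} (h₁ : 0 < r₁) (h₁₂ : r₁ ≤ r₂) (j : ℕ) :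
    IsIso (relativeSingularHomology.map R M (ContinuousMap.id ↥(closedBall (0 : E) r₂))
      (mapsTo_id_of_subset (sphere_subset_closedBall_annulus (E := E) h₁₂)) j) :=
  relativeSingularHomology.isIso_map_of_isZero R M (sphere_subset_closedBall_annulus h₁₂)
    (isZero_relativeSingularHomology_closedBall_annulus_sphere R M h₁ h₁₂) j

/-- Scaling `x ↦ r⁻¹ x`: the closed ball of radius `r > 0` is homeomorphic to the unit ball.
[folklore] -/
def closedBallScaleHomeomorph {r : ℝ} (hr : 0 < r) :
    ↥(closedBall (0 : E) r) ≃ₜ ↥(closedBall (0 : E) 1) where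
  toFun x := ⟨r⁻¹ • x.1, by
    rw [mem_closedBall_zero_iff, norm_smul, norm_inv, Real.norm_of_nonneg hr.le]
    exact (inv_mul_le_iff₀ hr).mpr (by simpa using mem_closedBall_zero_iff.mp x.2)⟩
  invFun y := ⟨r • y.1, by
    rw [mem_closedBall_zero_iff, norm_smul, Real.norm_of_nonneg hr.le]
    simpa using mul_le_mul_of_nonneg_left (mem_closedBall_zero_iff.mp y.2) hr.le⟩
  left_inv x := Subtype.ext (by simp [smul_smul, mul_inv_cancel₀ hr.ne'])
  right_inv y := Subtype.ext (by simp [smul_smul, inv_mul_cancel₀ hr.ne'])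
  continuous_toFun := by fun_prop
  continuous_invFun := by fun_prop

/-- Scaling maps the sphere of radius `r` to the unit sphere. [folklore] -/
theorem mapsTo_closedBallScaleHomeomorph {r : ℝ} (hr : 0 < r) :
    MapsTo (closedBallScaleHomeomorph (E := E) hr) (Subtype.val ⁻¹' sphere (0 : E) r)
      (Subtype.val ⁻¹' sphere (0 : E) 1) := by
  intro x hx
  rw [Set.mem_preimage, mem_sphere_zero_iff_norm] at hx ⊢
  change ‖r⁻¹ • (x : E)‖ = 1
  rw [norm_smul, norm_inv, Real.norm_of_nonneg hr.le, hx, inv_mul_cancel₀ hr.ne']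

/-- Scaling back maps the unit sphere to the sphere of radius `r`. [folklore] -/
theorem mapsTo_closedBallScaleHomeomorph_symm {r : ℝ} (hr : 0 < r) :
    MapsTo (closedBallScaleHomeomorph (E := E) hr).symm (Subtype.val ⁻¹' sphere (0 : E) 1)
      (Subtype.val ⁻¹' sphere (0 : E) r) := by
  intro y hy
  rw [Set.mem_preimage, mem_sphere_zero_iff_norm] at hy ⊢
  change ‖r • (y : E)‖ = r
  rw [norm_smul, Real.norm_of_nonneg hr.le, hy, mul_one]

/-- `Hⱼ(D_r, ∂D_r) ≅ Hⱼ(D₁, ∂D₁)` by scaling, `r > 0`. [folklore] -/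
def closedBallSphereScaleIso {r : ℝ} (hr : 0 < r) (j : ℕ) :
    relativeSingularHomology R M (↥(closedBall (0 : E) r)) (Subtype.val ⁻¹' sphere (0 : E) r) j ≅
      relativeSingularHomology R M (↥(closedBall (0 : E) 1)) (Subtype.val ⁻¹' sphere (0 : E) 1) j :=
  relativeSingularHomology.mapHomeomorph R M (closedBallScaleHomeomorph hr)
    (mapsTo_closedBallScaleHomeomorph hr) (mapsTo_closedBallScaleHomeomorph_symm hr) j

/-- **`Hⱼ(D_{r₂}, D_{r₂} ∩ {r₁ ≤ ‖x‖}) ≅ Hⱼ(D₁, ∂D₁)`** for `0 < r₁ ≤ r₂`: the annulus retracts onto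
the outer sphere (exact sequence of the triple) and the ball of radius `r₂` scales to the unit
ball. [cite: HatcherAT2002, §2.1 (Example 2.17, Prop. 2.22), with Ch. 0, p. 2] -/
def closedBallAnnulusIso {r₁ r₂ : ℝ} (h₁ : 0 < r₁) (h₁₂ : r₁ ≤ r₂) (j : ℕ) :
    relativeSingularHomology R M (↥(closedBall (0 : E) r₂))
        {x : ↥(closedBall (0 : E) r₂) | r₁ ≤ ‖(x : E)‖} j ≅
      relativeSingularHomology R M (↥(closedBall (0 : E) 1)) (Subtype.val ⁻¹' sphere (0 : E) 1) j :=
  haveI := isIso_map_closedBall_sphere_annulus R M (E := E) h₁ h₁₂ j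
  (asIso (relativeSingularHomology.map R M (ContinuousMap.id ↥(closedBall (0 : E) r₂))
    (mapsTo_id_of_subset (sphere_subset_closedBall_annulus (E := E) h₁₂)) j)).symm ≪≫
      closedBallSphereScaleIso R M (h₁.trans_le h₁₂) j

end DiscAnnulus

end Literature.AlgebraicTopology.SingularHomology
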